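import Summits.QuantumFields.YangMills.Theorems.BalabanUVNodesClustersCore
import Summits.QuantumFields.YangMills.Theorems.LangevinControlUVOSLegsFromFemtoAndGapDefs
import HarnessLib

/-!
# Route `BalabanLadder`, crux `UVOtherGroups` (stmt-QuantumFields-19356): the `SU(N)` part in apex currency — vocabulary

Route-posited objects (D-0016 `<Route><Crux>Defs` file) for the RESIDUAL leg `UVOtherGroups` of the spine route
`route-QuantumFields-BalabanLadder` (`Theses/BalabanLadder.lean` :547): for every compact simple `G` NOT isomorphic (as a topological
group) to `SU(2)`, every lattice representation `r` and every positive unit map `a → 0` carrying the non-triviality floors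
`LowerBounds G r a`, the plane-resolved centred-moment ceilings `MomentBounds6 G r a`.  The item's own text splits the groups in two:
«the SU(N) part is typable in apex currency (pub-ymgap plan `UVGroupStep` (i), kernel `YMPlanD59.uv_of_uvSUN`), the non-SU(N) compact
simple groups (Spin, Sp, exceptional) are not typable over tree declarations today (the printed averaging prescriptions and NODE 00 are
typed on `Matrix.specialUnitaryGroup (Fin N) ℂ` only)».  This file TYPES that split over tree declarations only; the kernels
(`uv_of_uvSUN`, `uvOtherGroups_of_split`, …) are `Theorems/BalabanLadderUVOtherGroupsSUN.lean`.  NOTHING here is asserted: every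
`def … : Prop` is a statement a line of the crux proves or consumes; none is a literature fact and none restates the crux as a claim.

* §1 APEX CURRENCY AT `SU(N)`: `UVSUN` — Bałaban's apex package at the datum of record for EVERY `SU(N)`, `N ≥ 2`, i.e.
  `∀ N ≥ 2, YMDAG.UVSplit.UVD59 N` where `UVD59 N` (Track A, `Theorems/BalabanUVNodesClustersCore.lean` :122) is the spine's rung-R4 leaf
  `Theses.BalabanLadder.UV` with `SU(2) ↦ SU(N)` (`YMDAG.UVSplit.uvD59_two_iff : UVD59 2 ↔ Theses.BalabanLadder.UV`, `Iff.rfl`).  This is the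
  pub-ymgap plan's `YMPlanD59.UVSUN` (g58 sketch `D59-UVCruxD59.lean`, 2026-08-25) stated BY NAME over the tree's `UVD59` instead of re-typing
  its body; the plan kernel `uv_of_uvSUN : UVSUN → Theses.BalabanLadder.UV` is in the kernels file.
* §2 Y2 CURRENCY: `CeilingsOfFloors G` — the common CONCLUSION SHAPE of the route's `UVSeam` and `UVOtherGroups` at one compact group `G`
  («in every positive unit `a → 0` carrying the floors, the ceilings»); `UVSeamSUN` — THE `SU(N)` SEAM, `N ≥ 3`: apex package at `SU(N)` ⇒
  `CeilingsOfFloors (SU(N))` (the `SU(N)` twin of the route's banked `UVSeam` :567, stated AT the matrix group — the transport to every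
  `G ≃ₜ* SU(N)` is a theorem, `ceilingsOfFloors_of_continuousMulEquiv`); `UVNonSUN` — THE RESIDUAL: `CeilingsOfFloors G` for the compact simple
  `G` admitting NO `G ≃ₜ* SU(N)`, `N ≥ 2` (Spin(n) n ≥ 7 and n = 5, Sp(n) n ≥ 2 (n ≠ 2 ↔ Spin 5 …), the exceptional groups, and the
  non-simply-connected quotients such as `SO(3)`, `PSU(N)`: no averaging prescription and no NODE 00 layer is typed for them today).
  Kernel: `UVSUN → UVSeamSUN → UVNonSUN → Theses.BalabanLadder.UVOtherGroups` (`uvOtherGroups_of_split`).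

HONEST FRAMING: bookkeeping of a CONDITIONAL chain — `UVSUN` is Bałaban's programme [B4]–[B16] per `SU(N)` (the `N`-dependence of every
constant is tracked nowhere in print), `UVSeamSUN` owes per `N` the same unprinted E0′/window content as the `SU(2)` seam
(`Literature.Barriers.QuantumFields.UVStabilityNonUniqueness`), `UVNonSUN` is not even typable at apex resolution.  Not a gap, not Clay.
Refs: T. Bałaban, Commun. Math. Phys. 109 (1987) 249 [B12] (0.1)–(0.4), Thm 2; Commun. Math. Phys. 98 (1985) 17 (averaging on `SU(N)`);
Commun. Math. Phys. 122 (1989) 355 [B16] Thm 1 p. 356; Bröcker–tom Dieck 1985 III (4.1) (pull-back of faithful representations).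
-/

set_option autoImplicit false

noncomputable section

open MeasureTheory Filter Topology
open Literature.MathematicalPhysics.QuantumFieldTheory
open Summit.QuantumFields.YangMills.Cruxes.OSLegsFromFemtoAndGap.DlrCollarTransfer

namespace Summit.QuantumFields.YangMills.Theorems.UVOtherGroups

/-! ## §1 Apex currency at `SU(N)` -/

/-- **`UVSUN` — Bałaban's apex package at the datum of record for every `SU(N)`, `N ≥ 2`** (the pub-ymgap plan's `YMPlanD59.UVSUN`,
«UVGroupStep (i), the typable part of the group step»): for every `N ≥ 2` and every four-torus lattice family `F` there is a finite-`ε`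
datum on `SU(N)` whose averaging maps are Bałaban's printed block averaging (`Node00.IsDatumOfRecord₀ F N D`) AT WHICH (B) = [B16] Thm 1
∧ (0.1) as printed, endpoint existence of the coupling flow and the hybrid-NE7 spine package hold — by name, Track A's rung
`YMDAG.UVSplit.UVD59 N` (whose `N = 2` instance IS the spine's leaf `Theses.BalabanLadder.UV`, `YMDAG.UVSplit.uvD59_two_iff`).
OPEN for every `N`; never asserted. -/
def UVSUN : Prop :=
  ∀ (N : ℕ) [NeZero N], 2 ≤ N → YMDAG.UVSplit.UVD59 N

/-! ## §2 Y2 currency: the seam shape at one group, the `SU(N)` seam, the non-`SU(N)` residual -/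

section Shape

variable (G : Type) [Group G] [TopologicalSpace G] [IsTopologicalGroup G] [CompactSpace G]
  [MeasurableSpace G] [BorelSpace G]

/-- **`CeilingsOfFloors G` — «in every unit carrying the floors, the ceilings» at the compact group `G`**: for every lattice
representation `r` of `G` and every positive unit map `a → 0`, the non-triviality floors `LowerBounds G r a` (smeared truncated
two-point and connected three-point functions of `tr_r F²` bounded below, volume-uniformly) imply the plane-resolved centred-moment
ceilings `MomentBounds6 G r a` (E0′, `(C/R⁴)ⁿ` hyperscaling bounds, `a`-uniform).  Verbatim the conclusion of the route's `UVSeam`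
(:567) and `UVOtherGroups` (:547) after their group guards; stated over the ambient Borel structure of `G`. -/
def CeilingsOfFloors : Prop :=
  ∀ (r : LatticeRep G) (a : ℝ → ℝ), (∀ β, 0 < a β) → Tendsto a atTop (𝓝 0) → LowerBounds G r a → MomentBounds6 G r a

end Shape

/-- **`UVSeamSUN` — the `SU(N)` seam, `N ≥ 3`** (the `SU(N)` twin of the route's banked `SU(2)` seam `UVSeam`, at the matrix group
itself): IF Bałaban's apex package holds at the datum of record on `SU(N)` (`YMDAG.UVSplit.UVD59 N`) THEN `CeilingsOfFloors (SU(N))` —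
for every lattice representation of `SU(N)` and every positive unit map `a → 0` carrying the floors, the E0′ ceilings (the tree's Borel
instances on `SU(N)`, `= borel _` by `rfl`).  Honest content per `N`, none of it in print: the measure dictionary (D0), Bałaban's
small-field representation of the DENSITIES ⇒ `a`-uniform bounds for EXPECTATIONS of plaquette strings (E0′, announced [B16] p. 356, never
printed), and the calibration window (W).  The transport to every compact `G ≃ₜ* SU(N)` is the theorem
`UVOtherGroups.ceilingsOfFloors_of_continuousMulEquiv` (Haar uniqueness), so nothing is lost by stating the seam at `SU(N)`.
OPEN for every `N`; never asserted. -/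
def UVSeamSUN : Prop :=
  ∀ (N : ℕ) [NeZero N], 3 ≤ N → YMDAG.UVSplit.UVD59 N → CeilingsOfFloors (Matrix.specialUnitaryGroup (Fin N) ℂ)

/-- **`UVNonSUN` — the non-`SU(N)` residual of the leg**: for every compact simple `G` (Borel σ-algebra) admitting NO topological-group
isomorphism `G ≃ₜ* SU(N)` for any `N ≥ 2` — the spin, symplectic and exceptional classes and the non-simply-connected quotients —
`CeilingsOfFloors G`.  Not typable at apex resolution today (Bałaban's averaging prescriptions [Balaban1985Averaging] and the NODE 00
layer are typed on `Matrix.specialUnitaryGroup (Fin N) ℂ` only); recorded so that the `SU(N)`-typable part of `UVOtherGroups` can be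
split off by a kernel-checked theorem (`uvOtherGroups_of_split`).  OPEN; never asserted. -/
def UVNonSUN : Prop :=
  ∀ (G : Type) [Group G] [TopologicalSpace G] [IsTopologicalGroup G] [CompactSpace G],
    IsCompactSimpleLieGroup G → (∀ N : ℕ, 2 ≤ N → IsEmpty (G ≃ₜ* Matrix.specialUnitaryGroup (Fin N) ℂ)) →
    letI : MeasurableSpace G := borel G; haveI : BorelSpace G := ⟨rfl⟩; CeilingsOfFloors G

/-! ## §3 The `SU(N)` seam in WITNESS form (appended 2026-08-26; candidate text, the route owner's ∕ planner's choice)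

LOCATED REMARK (seat ym-osasm-p2, on landing `uvOtherGroups_of_split`): the leg `UVOtherGroups` — hence its exact `SU(N)`-class content
`UVSeamSUN` — quantifies over EVERY lattice representation `r : LatticeRep G`, and in `MomentBounds6 G r a` both the Wilson measure
(`wilsonMeasure r.ρ β` inside `DlrCollarTransfer.torusE`) and the observables (`plane G r` = `plaquetteObs r.ρ`) live in the representation
`r`; the apex package `UVD59 N` is Bałaban's theorem for the FUNDAMENTAL Wilson action only (`FiniteEpsData.real` ↔ `Missing.boltzmann` =
`exp (−β · wilsonAction4)`, `GaugeGroup.reTr` of the defining representation).  So `UVSeamSUN` asks, beyond E0′ at the fundamental representation, UNIVERSALITY across faithful representations — the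
over-reach the `UVSeamRec` lead located in that crux's v3 `stub_ceilings` (reshape v4-F fixed `rF := fundamentalLatticeRep 2`).  The
∀-shape is forced on the residual leg by `closes`' second branch, which feeds `UVOtherGroups` the UNKNOWN witness `r` of `NT`.  The
witness shape below (the `SU(N)` twin of the spine's `UVSeamRec`, unit existential since the tree's unit of record `FemtoTransferGap.sizeLog`
carries the `SU(2)` coefficients `b₀ = 11/(24π²)`, `b₁ = 17/(96π⁴)` only) has no such over-reach and composes into `YangMills` through the
bridge `Y2Bridge.yangMills_of_legs` with the spine's `UV`, `UVSeamRec`, `NT`, `IR`, `ROT` and the residual `UVNonSUN`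
(`Theorems.UVOtherGroups.yangMills_of_witnessSplit`).  Typed here so a planner can file it over a bare identifier; NOTHING is asserted. -/

/-- **`UVSeamWitnessSUN` — the `SU(N)` seam in witness form, `N ≥ 3`** (the `SU(N)` twin of the spine's `UVSeamRec` :470, unit existential):
IF Bałaban's apex package holds at the datum of record on `SU(N)` (`YMDAG.UVSplit.UVD59 N`) THEN there are ONE lattice representation `r`
of `SU(N)` and ONE positive unit map `a → 0` carrying BOTH the non-triviality floors `LowerBounds SU(N) r a` AND the E0′ ceilings
`MomentBounds6 SU(N) r a` (intended: `r` = the fundamental representation of Bałaban's Wilson action, `a` = the `SU(N)` two-loop unit or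
Bałaban's own unit).  Honest content per `N`: E0′ at the fundamental representation (UV-consuming, unprinted) + the non-triviality engine at
`SU(N)` (dimensional transmutation, `Literature.Barriers.QuantumFields.PerturbativeInvisibility`) in commensurable units — it SUBSUMES the
spine's `NT` for the `SU(N)` class and is implied by `UVSeamSUN` + floors at `SU(N)` (`uvSeamWitnessSUN_of_uvSeamSUN`).  Every compact
`G ≃ₜ* SU(N)` inherits the witness by Haar transport (`legsWitness_of_continuousMulEquiv`).  OPEN for every `N`; never asserted. -/
def UVSeamWitnessSUN : Prop :=
  ∀ (N : ℕ) [NeZero N], 3 ≤ N → YMDAG.UVSplit.UVD59 N →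
    ∃ (r : LatticeRep (Matrix.specialUnitaryGroup (Fin N) ℂ)) (a : ℝ → ℝ), (∀ β, 0 < a β) ∧ Tendsto a atTop (𝓝 0) ∧
      LowerBounds (Matrix.specialUnitaryGroup (Fin N) ℂ) r a ∧ MomentBounds6 (Matrix.specialUnitaryGroup (Fin N) ℂ) r a

end Summit.QuantumFields.YangMills.Theorems.UVOtherGroups

end
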